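import Summits.Parity.GeneralizedHardyLittlewood.Theses.ChenParityOracleBLAP

/-!
# Route `ChenParityOracleBLAP` — the `Assembly` item (stmt-Parity-20047)

`Assembly : BilinearLiouvilleMean → BilinearLiouvilleAP → HostParityFromBrick → ParityOracleChen →
TwinLowerDensityToGHL → GeneralizedHardyLittlewood` is pure logic through the in-cone node
`T = TwinLowerDensity`: S1 (`HostParityFromBrick`) turns the brick (K1, K2) into the two host-parity
level statements (HP1, HP2), S2 (`ParityOracleChen`, proved:
`Summit.Parity.GeneralizedHardyLittlewood.Theorems.parityOracleChen_proof`) turns those into `T`, and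
the declared residual `R = TwinLowerDensityToGHL` turns `T` into the Statement.  This file records the
composite exactly as the route's deciding theorem `closes` uses it.  Honesty label: closing this item
proves no number theory — K1, K2 (the Liouville brick) and R (GHL beyond twin lower density) remain
OPEN; the route is a CONDITIONAL reduction.

References: Chen Jing-run, Sci. Sinica 16 (1973) [ChenSciSinica1973]; M. B. Nathanson, Additive
Number Theory: The Classical Bases (1996), Ch. 10 [Nathanson1996].
-/

namespace Summit.Parity.GeneralizedHardyLittlewood.Theorems

/-- **`Assembly` PROVED** (item stmt-Parity-20047): from K1 = `BilinearLiouvilleMean`,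
K2 = `BilinearLiouvilleAP`, S1 = `HostParityFromBrick`, S2 = `ParityOracleChen` and the residual
R = `TwinLowerDensityToGHL`, the sub-problem Statement `GeneralizedHardyLittlewood` follows by
composition: `r (s₂ (s₁ k₁ k₂).1 (s₁ k₁ k₂).2)`.  Pure logic; no analytic content.
[cite: ChenSciSinica1973, Theorem 1; Nathanson1996, Ch. 10] -/
theorem chenParityOracleBLAP_assembly_proof :
    Summit.Parity.GeneralizedHardyLittlewood.Theses.ChenParityOracleBLAP.Assembly :=
  fun k₁ k₂ s₁ s₂ r => r (s₂ (s₁ k₁ k₂).1 (s₁ k₁ k₂).2)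

end Summit.Parity.GeneralizedHardyLittlewood.Theorems
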